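import Literature.Computability.AlgebraicComplexity.ABV17SingPermFourCodim
import HarnessLib

/-!
# PolyaContinued / CoverDecancellation, line `laplace_rigidity` — THE (4,2) LOWER RUNG, UNCONDITIONAL:
# `str₂(per₄) ≥ 4`

Helper file for crux `CoverDecancellation` (stmt-ValiantsHypothesis-17819), line `laplace_rigidity`
(val-idea-10; `Cruxes/CoverDecancellation/Lines/laplace_rigidity.lean`, def `StrengthTwoPerFourGeFour`).
The line's law `LaplaceRigidity` predicts `str_k(per_n) = C(n,k)`; its first per/det-SEPARATING
instance is `(n,k) = (4,2)`: `det₄ = D₁₂D₃₄ − D₁₃D₂₄ + D₁₄D₂₃` is a sum of THREE products of two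
quadrics (arXiv:2509.06294 Thm 3), and this file proves that `per₄` is NOT:

* `strengthTwoPerFourGeFour` — for all `p q : Fin 3 → ℂ[x_{4×4}]` with `p_i, q_i` homogeneous of
  degree `2`, `per₄ ≠ Σ_{i<3} p_i q_i`.  PROOF: `codim Sing(per₄) ≥ 7`
  (`Literature.….AlperBogartVelasco.seven_le_height_singPermIdeal_four`, the k = 4 case of von zur
  Gathen's problem, PROVED in the tree by generic-point case analysis — Alper–Bogart–Velasco 2017 §1
  report `= 8` by computer) fed into Kumar's ideal / GGIL22 Prop. 6
  (a width-`w` decomposition `f = Σ p_i q_i` with constant-free factors forces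
  `codim Sing(f) ≤ 2w = 6`: the proper ideal `(p_i, q_i)` contains `f` and its partials — Leibniz —
  and Krull's height theorem; re-proved here privately so that this file imports Literature only and
  stays outside the route cone; the conditional form is
  `PolyaContinuedLaplaceRigidityStrength.strengthTwoPerFourGeFour_of_seven_le_height`).
* `strengthTwoPerFourGeFour_isTwoFactorDecomp` — the same in the workfile's packaging
  (`¬ IsTwoFactorDecomp 4 2 3 p q` unfolded, with `q_i` homogeneous of degree `4 - 2`).

So `4 ≤ str₂(per₄) ≤ 6` (Laplace along two rows gives six); the route's support item
`StrengthTwoPerFour` (stmt-25160: width `5` impossible, i.e. `str₂(per₄) = 6`) remains OPEN, as do the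
law `CentralLaplaceRigidity`, the crux `CoverDecancellation` and VP ≠ VNP — NOT moved by this file
beyond the rung stated.

References: Alper–Bogart–Velasco, Found. Comput. Math. 17 (2017), §1; Gesmundo–Ghosal–Ikenmeyer–
Lysikov, arXiv:2205.02149, Prop. 6 / Cor. 13; Kumar, comput. complexity 28 (2019), §1.2.
-/

-- single-conjunct layout: Sub = Summit, duplicated namespace component intended
set_option linter.dupNamespace false

noncomputable section

open MvPolynomial

namespace Summit.ValiantsHypothesis.ValiantsHypothesis.Theorems.PolyaContinuedLaplaceRigidity.Strength

open Literature.Computability.AlgebraicComplexity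

/-- Kumar's ideal, height form (private copy of
`Strength.height_singIdeal_le_of_eq_sum_mul`, kept here to avoid importing the route cone): if
`f = Σ_{i ∈ ι} p_i q_i` with all factors constant-free then `(singIdeal f).height ≤ 2|ι|`.
[cite: GesmundoGhosalIkenmeyerLysikov2022, Prop. 6] -/
private theorem height_singIdeal_le_aux {K : Type*} [Field K] {σ : Type*} [Finite σ] {ι : Type*}
    [Fintype ι] {f : MvPolynomial σ K} (p q : ι → MvPolynomial σ K) (hf : f = ∑ i, p i * q i)
    (hp : ∀ i, constantCoeff (p i) = 0) (hq : ∀ i, constantCoeff (q i) = 0) :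
    (singIdeal f).height ≤ 2 * Fintype.card ι := by
  classical
  set S : Finset (MvPolynomial σ K) := Finset.univ.image p ∪ Finset.univ.image q with hS
  set I : Ideal (MvPolynomial σ K) := Ideal.span (S : Set _) with hI
  have hpI : ∀ i, p i ∈ I := fun i => Ideal.subset_span (Finset.mem_coe.2
    (Finset.mem_union_left _ (Finset.mem_image_of_mem p (Finset.mem_univ i))))
  have hqI : ∀ i, q i ∈ I := fun i => Ideal.subset_span (Finset.mem_coe.2
    (Finset.mem_union_right _ (Finset.mem_image_of_mem q (Finset.mem_univ i))))
  have hScard : S.card ≤ 2 * Fintype.card ι :=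
    calc S.card ≤ (Finset.univ.image p).card + (Finset.univ.image q).card :=
          Finset.card_union_le _ _
      _ ≤ (Finset.univ : Finset ι).card + (Finset.univ : Finset ι).card :=
          add_le_add Finset.card_image_le Finset.card_image_le
      _ = 2 * Fintype.card ι := by rw [Finset.card_univ, two_mul]
  have hsing : singIdeal f ≤ I := by
    rw [singIdeal_le_iff, hf]
    refine ⟨Ideal.sum_mem _ fun i _ => Ideal.mul_mem_left _ _ (hqI i), fun x => ?_⟩
    rw [map_sum]
    refine Ideal.sum_mem _ fun i _ => ?_
    rw [Derivation.leibniz, smul_eq_mul, smul_eq_mul]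
    exact Ideal.add_mem _ (Ideal.mul_mem_right _ _ (hpI i)) (Ideal.mul_mem_right _ _ (hqI i))
  have hIker : I ≤ RingHom.ker (constantCoeff : MvPolynomial σ K →+* K) := by
    rw [hI, Ideal.span_le]
    intro g hg
    rw [SetLike.mem_coe, RingHom.mem_ker]
    rw [Finset.mem_coe, hS, Finset.mem_union, Finset.mem_image, Finset.mem_image] at hg
    rcases hg with ⟨i, -, rfl⟩ | ⟨i, -, rfl⟩
    · exact hp i
    · exact hq i
  have hItop : I ≠ ⊤ := fun htop => RingHom.ker_ne_top _ (top_le_iff.1 (htop ▸ hIker))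
  obtain ⟨Q, hQ⟩ := Ideal.nonempty_minimalPrimes hItop
  calc (singIdeal f).height ≤ Q.height := Ideal.height_mono (hsing.trans hQ.1.2)
    _ ≤ S.card := Ideal.height_le_card_of_mem_minimalPrimes_span_finset hQ
    _ ≤ (2 * Fintype.card ι : ℕ) := by exact_mod_cast hScard

/-- **`str₂(per₄) ≥ 4` (the (4,2) lower rung of line `laplace_rigidity`, UNCONDITIONAL)**: the
`4 × 4` permanent over `ℂ` is not a sum of three products `p_i q_i` of homogeneous quadrics.
(`det₄` is such a sum of three.)  From `codim Sing(per₄) ≥ 7` (tree,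
`AlperBogartVelasco.seven_le_height_singPermIdeal_four`) and Kumar's ideal (`codim Sing ≤ 6` for a
width-3 decomposition). [cite: AlperBogartVelasco2017, §1 (sentence introducing Cor. 1.4)] -/
theorem strengthTwoPerFourGeFour :
    ∀ p q : Fin 3 → MvPolynomial (Fin 4 × Fin 4) ℂ,
      ¬ ((∀ i, (p i).IsHomogeneous 2) ∧ (∀ i, (q i).IsHomogeneous 2) ∧
        perPoly (Fin 4) ℂ = ∑ i, p i * q i) := by
  rintro p q ⟨hp, hq, hf⟩
  have hle := height_singIdeal_le_aux p q hf
    (fun i => AlperBogartVelasco.constantCoeff_eq_zero_of_isHomogeneous (hp i) two_ne_zero)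
    (fun i => AlperBogartVelasco.constantCoeff_eq_zero_of_isHomogeneous (hq i) two_ne_zero)
  have h7 : (7 : ℕ∞) ≤ (singIdeal (perPoly (Fin 4) ℂ)).height := by
    rw [singIdeal_perPoly]
    exact AlperBogartVelasco.seven_le_height_singPermIdeal_four ℂ two_ne_zero
  rw [Fintype.card_fin] at hle
  have h := h7.trans hle
  norm_num at h

/-- The same rung in the packaging of the crux workfile's `IsTwoFactorDecomp 4 2 3 p q`
(`q_i` homogeneous of degree `4 - 2`): no `(2, 4-2)` two-factor decomposition of `per₄` of width `3`.
[cite: AlperBogartVelasco2017, §1 (sentence introducing Cor. 1.4)] -/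
theorem strengthTwoPerFourGeFour_isTwoFactorDecomp :
    ∀ p q : Fin 3 → MvPolynomial (Fin 4 × Fin 4) ℂ,
      ¬ ((∀ i, (p i).IsHomogeneous 2) ∧ (∀ i, (q i).IsHomogeneous (4 - 2)) ∧
        perPoly (Fin 4) ℂ = ∑ i, p i * q i) :=
  strengthTwoPerFourGeFour

end Summit.ValiantsHypothesis.ValiantsHypothesis.Theorems.PolyaContinuedLaplaceRigidity.Strength

end
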